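import Summits.QuantumFields.YangMills.Theses.UnitScaleTilt
import Summits.QuantumFields.YangMills.Theorems.AlphaInputsT3ACv3Histories
import Summits.QuantumFields.YangMills.Theorems.AlphaInputsT3ACv3Rows
import Summits.QuantumFields.YangMills.Theorems.UnitScaleTiltHistoryTailAlphaConsumer
import Summits.QuantumFields.YangMills.Theorems.UnitScaleTiltHistoryTailDiluteExponentCV3
import Summits.QuantumFields.YangMills.Theorems.UnitScaleTiltHistoryTailHistoryMassWCV3
import Summits.QuantumFields.YangMills.Theorems.UnitScaleTiltHistoryTailLowMassV3
import Summits.QuantumFields.YangMills.Theorems.UnitScaleTiltHistoryTailChessboardT3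
import Summits.QuantumFields.YangMills.Theorems.UnitScaleTiltHistoryTailStubBudget
import HarnessLib

/-!
# Route `UnitScaleTilt` — crux K2-L `HistoryTailL` (stmt-QuantumFields-19936): THE NUMERATOR BOUND ON A JOINT LARGE-PLAQUETTE EVENT AND THE EXPONENT ALGEBRA
# (fleet lead `ym-ust-18916-p1` g5; `--supports` 19936; part 2/3 of the Theorems landing of skeleton v5p7's sorry-free cone — lineage g2–g5)

* `gibbsK_real_iInter_le` — Mechanism A on the joint event `⋂_{q∈S} E′(q)` from the a.e. envelopes (41′)/(47′) of a datum and a numerator bound;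
* `root_bound`, `exponent_bound`, `xlog_mono`, `mass_budget`, `budget_of_c` — the |S|-th root, the exponent algebra at small-factor constant `c`, the large-field
  budget `exp(−c·p² + κx^a) = (exp(−p²/4 + (κ/4c)x^a))^{4c}` over v4's `stub_budget` (p442213);
* `setIntegral_up_le` — for the v3 datum with a windowed weight family: `∫_{E_S} U ≤ e^{−|S|·P4}·(MA + e^{Pz}·MT)` from 4c (exponent), 4a (history mass), the
  trivial-weight mass, the a.e. supports and the interaction size.
All [folklore] measure theory / real analysis over the tree's objects; nothing of [Balaban1985UV3] is asserted. [cite: Balaban1985UV3, (41) p.266, (47) p.267 and (71) p.273]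
-/

set_option autoImplicit false

noncomputable section

open MeasureTheory
open Literature.MathematicalPhysics.QuantumFieldTheory.Balaban1983to89
open Literature.MathematicalPhysics.QuantumFieldTheory.Balaban1983to89.T3ContinuumYM3Torus
open Literature.MathematicalPhysics.QuantumFieldTheory.Balaban1983to89.T3UnitScaleTilt
open Literature.MathematicalPhysics.QuantumFieldTheory.Balaban1983to89.T3UnitLawDensityEML
open Literature.MathematicalPhysics.QuantumFieldTheory.Balaban1983to89.T3ThresholdSmallness (sqrt_coupling_pos_le)
open Literature.MathematicalPhysics.QuantumFieldTheory.Balaban1983to89.T3Thresholds (coupling_le_one)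
open Literature.MathematicalPhysics.QuantumFieldTheory.Balaban1983to89.T3AlphaInputsAC
open Literature.MathematicalPhysics.QuantumFieldTheory.Balaban1983to89.T3AlphaInputsACSchemas
open Literature.MathematicalPhysics.QuantumFieldTheory.Balaban1983to89.B10Eq38TorusDomains (toFine)
open Literature.MathematicalPhysics.QuantumFieldTheory.Balaban1983to89.T3RestrictedUnitDensity (resDensity integrable_resDensity)
open Literature.MathematicalPhysics.QuantumFieldTheory.Balaban1983to89.Missing (partitionFn measurable_plaqHol)
open Summit.QuantumFields.Balaban3D.Carriers (suGroupModel)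
open Summit.QuantumFields.Balaban3D.Proofs.Primitives (AlphaConsts)
open Summit.QuantumFields.Balaban3D.Proofs.Run3SmallFactors (regionT src_mem_plaqCover_of_mem_regionT)
open Summit.QuantumFields.YangMills.Theorems
open Summit.QuantumFields.YangMills.Theorems.HistoryTailDensityTransfer (gibbsK_real_preimage_iter_eq)
open Summit.QuantumFields.YangMills.Theorems.HistoryTailSandwich (partitionFn_eq_integral_resDensity)
open Summit.QuantumFields.YangMills.Theorems.HistoryTailMechanismA (integral_mul_indicator_one_eq_setIntegral)
open Summit.QuantumFields.YangMills.Theorems.HistoryTailAlphaConsumer (setIntegral_div_integral_le_ae)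

namespace Summit.QuantumFields.YangMills.Theorems.HistoryTailLaneNumerator

open Classical

/-- **MECHANISM A ON A JOINT LARGE-PLAQUETTE EVENT, FROM THE FOUR ENVELOPE CLAUSES** (re-cut of `HistoryTailAlphaConsumer.gibbsK_real_largePlaquette_le_of_alphaInputs`
/ v5p's `gibbsK_real_iInter_le_of_alphaInputs` to the clauses actually used, all DELIVERED for the concrete datum): (41′)/(47′) a.e., regular envelopes, `low ≥ 0`,
and a numerator bound `∫_{E_S} up ≤ B·∫ low` give `Gibbs_K(⋂_{q∈S}{θ ≤ |Ū^j(∂q) − 1|}) ≤ e^{2Rm_j}·B`. [cite: Balaban1985UV3, (41) p.266 and (47) p.267] -/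
theorem gibbsK_real_iInter_le {F : T3Family} {γ : ℝ} (hγ : 0 ≤ γ) {D : AlphaDataT3 F γ} {K j : ℕ} (hjK : j ≤ K)
    (h41 : Ineq41AE D K j) (h47 : Ineq47AE D K j) (hreg : EnvelopeRegular D K j) (hlow0 : ∀ W, 0 ≤ D.low K j W)
    (S : Finset (Plaq (F.P K) j)) (θ B : ℝ)
    (hnum : ∫ W in {W | ∀ q ∈ S, θ ≤ GaugeGroup.dist1 (GaugeField.plaqHol W q)}, D.up K j W
        ∂fieldMeasure (F.P K) j (Matrix.specialUnitaryGroup (Fin 2) ℂ) ≤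
      B * ∫ W, D.low K j W ∂fieldMeasure (F.P K) j (Matrix.specialUnitaryGroup (Fin 2) ℂ)) :
    (gibbsK F ℰp γ K).real
        {U | ∀ q ∈ S, θ ≤ GaugeGroup.dist1 (GaugeField.plaqHol
          (Averaging.iter (fun _ => BlockAveraging.blockAvg ℰp) j U) q)} ≤
      Real.exp (2 * D.Rm K j) * B := by
  have hj : j ≤ F.m + K := hjK.trans (Nat.le_add_left K F.m)
  have hEeq : {W : GaugeField (F.P K) j (Matrix.specialUnitaryGroup (Fin 2) ℂ) |
        ∀ q ∈ S, θ ≤ GaugeGroup.dist1 (GaugeField.plaqHol W q)} =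
      ⋂ q ∈ S, {W | θ ≤ GaugeGroup.dist1 (GaugeField.plaqHol W q)} := by
    ext W; simp
  have hE : MeasurableSet {W : GaugeField (F.P K) j (Matrix.specialUnitaryGroup (Fin 2) ℂ) |
      ∀ q ∈ S, θ ≤ GaugeGroup.dist1 (GaugeField.plaqHol W q)} := by
    rw [hEeq]
    exact S.measurableSet_biInter fun q _ =>
      measurableSet_le measurable_const (RegularGaugeGroup.measurable_dist1.comp (measurable_plaqHol q))
  have hset : {U : GaugeField (F.P K) 0 (Matrix.specialUnitaryGroup (Fin 2) ℂ) |
        ∀ q ∈ S, θ ≤ GaugeGroup.dist1 (GaugeField.plaqHol (Averaging.iter (fun _ => BlockAveraging.blockAvg ℰp) j U) q)} =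
      (fun U => Averaging.iter (fun _ => BlockAveraging.blockAvg ℰp) j U) ⁻¹'
        {W | ∀ q ∈ S, θ ≤ GaugeGroup.dist1 (GaugeField.plaqHol W q)} := rfl
  rw [hset, gibbsK_real_preimage_iter_eq F hγ hj hE, partitionFn_eq_integral_resDensity F hγ hj,
    integral_mul_indicator_one_eq_setIntegral _ hE]
  exact setIntegral_div_integral_le_ae _ _ _ (D.up K j) (D.low K j) (D.Ecst K j) (D.Rm K j) B
    h41 h47 hlow0 (integrable_resDensity F K MeasurableSet.univ hγ hj) (integrableOn_up hreg _) hreg.1 hreg.2.2 hnum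

/-- **THE |S|-TH ROOT ARITHMETIC** (v5p): `a ≤ b^{1/n}`, `b ≤ CRm·e^{E}`, `n ≥ 1` ⇒ `a ≤ max(1, CRm)·e^{E/n}`. [folklore] -/
theorem root_bound {a b CRm E : ℝ} {n : ℕ} (hn : 1 ≤ n) (hb0 : 0 ≤ b) (hCRm : 0 ≤ CRm)
    (hab : a ≤ b ^ ((1 : ℝ) / (n : ℝ))) (hb : b ≤ CRm * Real.exp E) : a ≤ max 1 CRm * Real.exp (E / n) := by
  have hn0 : (0 : ℝ) < n := by exact_mod_cast hn
  have hexp : 0 ≤ (1 : ℝ) / (n : ℝ) := by positivity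
  have h1 : b ^ ((1 : ℝ) / (n : ℝ)) ≤ (CRm * Real.exp E) ^ ((1 : ℝ) / (n : ℝ)) := Real.rpow_le_rpow hb0 hb hexp
  have h2 : (CRm * Real.exp E) ^ ((1 : ℝ) / (n : ℝ)) = CRm ^ ((1 : ℝ) / (n : ℝ)) * Real.exp (E / n) := by
    rw [Real.mul_rpow hCRm (Real.exp_pos _).le, ← Real.exp_mul]
    congr 2
    field_simp
  have h3 : CRm ^ ((1 : ℝ) / (n : ℝ)) ≤ max 1 CRm := by
    by_cases hC1 : CRm ≤ 1
    · exact (Real.rpow_le_one hCRm hC1 hexp).trans (le_max_left _ _)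
    · have hC1' : 1 ≤ CRm := (not_le.mp hC1).le
      have hle : (1 : ℝ) / (n : ℝ) ≤ 1 := by
        rw [div_le_one hn0]; exact_mod_cast hn
      calc CRm ^ ((1 : ℝ) / (n : ℝ)) ≤ CRm ^ (1 : ℝ) := Real.rpow_le_rpow_of_exponent_le hC1' hle
        _ = CRm := Real.rpow_one _
        _ ≤ max 1 CRm := le_max_right _ _
  calc a ≤ b ^ ((1 : ℝ) / (n : ℝ)) := hab
    _ ≤ CRm ^ ((1 : ℝ) / (n : ℝ)) * Real.exp (E / n) := h1.trans_eq h2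
    _ ≤ max 1 CRm * Real.exp (E / n) := mul_le_mul_of_nonneg_right h3 (Real.exp_nonneg _)

/-- **THE EXPONENT BOOKKEEPING** (v5p): with `x ≥ 1`, `ρ = ccol·x^{r₀}` (`ccol ≥ 1`, `r₀ ≥ 0`), `T ≤ n·8(L(ρ+4))³` and `C ≥ 0`:
`(−¼P·n + C·x·T)/n ≤ −¼P + κ·x^{2+3r₀}` with `κ = 8CL³(ccol+4)³`. [folklore] -/
theorem exponent_bound {P4 C x L ccol r₀ T : ℝ} {n : ℕ} (hn : 1 ≤ n) (hC : 0 ≤ C) (hx : 1 ≤ x) (hL : 0 ≤ L)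
    (hccol : 1 ≤ ccol) (hr₀ : 0 ≤ r₀) (hT : T ≤ (n : ℝ) * (8 * (L * (ccol * x ^ r₀ + 4)) ^ 3)) :
    (-P4 * (n : ℝ) + C * x * T) / n ≤ -P4 + 8 * C * L ^ 3 * (ccol + 4) ^ 3 * x ^ (2 + 3 * r₀) := by
  have hn0 : (0 : ℝ) < n := by exact_mod_cast hn
  have hx0 : 0 < x := lt_of_lt_of_le one_pos hx
  have hxr : 1 ≤ x ^ r₀ := Real.one_le_rpow hx hr₀
  have hxr0 : 0 ≤ x ^ r₀ := le_trans zero_le_one hxr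
  have hρ : ccol * x ^ r₀ + 4 ≤ (ccol + 4) * x ^ r₀ := by nlinarith
  have hρ0 : 0 ≤ ccol * x ^ r₀ + 4 := by positivity
  have hcube : (L * (ccol * x ^ r₀ + 4)) ^ 3 ≤ (L * ((ccol + 4) * x ^ r₀)) ^ 3 :=
    pow_le_pow_left₀ (mul_nonneg hL hρ0) (mul_le_mul_of_nonneg_left hρ hL) 3
  have hpow3 : (x ^ r₀) ^ 3 = x ^ (3 * r₀) := by
    rw [← Real.rpow_natCast, ← Real.rpow_mul hx0.le]; norm_num; ring_nf
  have hx13 : x * x ^ (3 * r₀) = x ^ (1 + 3 * r₀) := by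
    rw [Real.rpow_add hx0, Real.rpow_one]
  have hx23 : x ^ (1 + 3 * r₀) ≤ x ^ (2 + 3 * r₀) := Real.rpow_le_rpow_of_exponent_le hx (by linarith)
  have hdiv : (-P4 * (n : ℝ) + C * x * T) / n = -P4 + C * x * (T / n) := by
    field_simp
  rw [hdiv]
  have hTn : T / n ≤ 8 * (L * (ccol * x ^ r₀ + 4)) ^ 3 := by
    rw [div_le_iff₀ hn0]; linarith
  have hCx : 0 ≤ C * x := mul_nonneg hC hx0.le
  calc -P4 + C * x * (T / n) ≤ -P4 + C * x * (8 * (L * ((ccol + 4) * x ^ r₀)) ^ 3) := by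
        have := mul_le_mul_of_nonneg_left (hTn.trans (mul_le_mul_of_nonneg_left hcube (by norm_num))) hCx
        linarith
    _ = -P4 + 8 * C * L ^ 3 * (ccol + 4) ^ 3 * (x * (x ^ r₀) ^ 3) := by ring
    _ = -P4 + 8 * C * L ^ 3 * (ccol + 4) ^ 3 * x ^ (1 + 3 * r₀) := by rw [hpow3, hx13]
    _ ≤ -P4 + 8 * C * L ^ 3 * (ccol + 4) ^ 3 * x ^ (2 + 3 * r₀) := by
        have hk : 0 ≤ 8 * C * L ^ 3 * (ccol + 4) ^ 3 := by positivity
        have := mul_le_mul_of_nonneg_left hx23 hk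
        linarith

/-! ### §2.1 The concrete datum with a windowed trivial weight: the numerator bound on a joint event -/

section Concrete

variable {F : T3Family} {𝔠 : AlphaConsts F.L (suGroupModel 2).N} {a₀ a₁ : ℝ}
  (h : AlphaInputsT3AC.OfV3At F 𝔠 a₀ a₁) (hc : 0 < a₀ ∧ 0 < a₁ ∧ 𝔠.B₃ * a₁ ≤ a₀) (γ : ℝ) (hγ : 0 < γ)
  (hγ1 : γ ≤ (min 𝔠.gamma0 1) ^ 2) (π : AlphaInputsT3AC.PolymerT3 F)

/-- **THE NUMERATOR BOUND ON A JOINT LARGE-PLAQUETTE EVENT FROM THE PIECES** (deterministic exponent bound 4c at this family, history mass 4a, a windowed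
trivial weight `wtT` with its mass bound, a.e. supports, interaction size): for a majorant `U(W) = wtT(W)·e^{Φ(triv,W)} + Σ_{r ≠ triv} m_j(r,W)·e^{Φ(r,W)}`,
`Φ(r,W) = −mainT + Pint + Zterm` of the concrete datum, `∫_{E_S} U ≤ e^{−|S|·P4}·(MA + e^{Pz}·MT)`. [cite: Balaban1985UV3, (41) p.266 and (71) p.273] -/
theorem setIntegral_up_le (K j : ℕ) (S : Finset (Plaq (F.P K) j)) (θ P4 MA MT Pz : ℝ) (σ : ℕ → ℝ) (hσ : ∀ i, i < j → 0 ≤ σ i)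
    (wt : Summit.QuantumFields.Balaban3D.Carriers.Hist (F.P K) j → GaugeField (F.P K) j (Matrix.specialUnitaryGroup (Fin 2) ℂ) → ℝ)
    (hwt0 : ∀ r Wf, 0 ≤ wt r Wf)
    (U wtT : GaugeField (F.P K) j (Matrix.specialUnitaryGroup (Fin 2) ℂ) → ℝ) (hwtT0 : ∀ Wf, 0 ≤ wtT Wf)
    (hU : ∀ Wf, U Wf = wtT Wf * Real.exp (-((h.dataT3v3 hc γ hγ hγ1 π).mainT K j (Summit.QuantumFields.Balaban3D.Carriers.Hist.triv (F.P K) j) Wf) +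
        (h.dataT3v3 hc γ hγ hγ1 π).Pint K j (Summit.QuantumFields.Balaban3D.Carriers.Hist.triv (F.P K) j) Wf +
        (h.dataT3v3 hc γ hγ hγ1 π).Zterm K j (Summit.QuantumFields.Balaban3D.Carriers.Hist.triv (F.P K) j)) +
      ∑ r ∈ Finset.univ.erase (Summit.QuantumFields.Balaban3D.Carriers.Hist.triv (F.P K) j),
        wt r Wf *
          Real.exp (-((h.dataT3v3 hc γ hγ hγ1 π).mainT K j r Wf) + (h.dataT3v3 hc γ hγ hγ1 π).Pint K j r Wf + (h.dataT3v3 hc γ hγ hγ1 π).Zterm K j r))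
    (h4c : ∀ (r : Summit.QuantumFields.Balaban3D.Carriers.Hist (F.P K) j) (Wf : GaugeField (F.P K) j (Matrix.specialUnitaryGroup (Fin 2) ℂ)),
      (h.dataT3v3 hc γ hγ hγ1 π).Adm K j r Wf → (∀ q ∈ S, θ ≤ GaugeGroup.dist1 (GaugeField.plaqHol Wf q)) →
        (S.card : ℝ) * P4 + ∑ i ∈ Finset.range j, (((h.lfDataT3v3 hc γ hγ hγ1 π).LargeP K j r i).card : ℝ) * σ i ≤
          (h.dataT3v3 hc γ hγ hγ1 π).mainT K j r Wf - (h.dataT3v3 hc γ hγ hγ1 π).Zterm K j r)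
    (hT1 : ∀ r : Summit.QuantumFields.Balaban3D.Carriers.Hist (F.P K) j, r ≠ Summit.QuantumFields.Balaban3D.Carriers.Hist.triv (F.P K) j →
      ∀ᵐ Wf ∂fieldMeasure (F.P K) j (Matrix.specialUnitaryGroup (Fin 2) ℂ),
        wt r Wf ≠ 0 → (h.dataT3v3 hc γ hγ hγ1 π).Adm K j r Wf)
    (hT1' : ∀ᵐ Wf ∂fieldMeasure (F.P K) j (Matrix.specialUnitaryGroup (Fin 2) ℂ),
      wtT Wf ≠ 0 → (h.dataT3v3 hc γ hγ hγ1 π).Adm K j (Summit.QuantumFields.Balaban3D.Carriers.Hist.triv (F.P K) j) Wf)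
    (hPint : ∀ (r : Summit.QuantumFields.Balaban3D.Carriers.Hist (F.P K) j) (Wf : GaugeField (F.P K) j (Matrix.specialUnitaryGroup (Fin 2) ℂ)),
      (h.dataT3v3 hc γ hγ hγ1 π).Adm K j r Wf → (h.dataT3v3 hc γ hγ hγ1 π).Pint K j r Wf ≤ Pz)
    (h4a : Integrable (fun Wf : GaugeField (F.P K) j (Matrix.specialUnitaryGroup (Fin 2) ℂ) =>
        ∑ r ∈ Finset.univ.erase (Summit.QuantumFields.Balaban3D.Carriers.Hist.triv (F.P K) j),
          wt r Wf *
            Real.exp ((h.dataT3v3 hc γ hγ hγ1 π).Pint K j r Wf -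
              ∑ i ∈ Finset.range j, (((h.lfDataT3v3 hc γ hγ hγ1 π).LargeP K j r i).card : ℝ) * σ i))
        (fieldMeasure (F.P K) j (Matrix.specialUnitaryGroup (Fin 2) ℂ)) ∧
      ∫ Wf, ∑ r ∈ Finset.univ.erase (Summit.QuantumFields.Balaban3D.Carriers.Hist.triv (F.P K) j),
          wt r Wf *
            Real.exp ((h.dataT3v3 hc γ hγ hγ1 π).Pint K j r Wf -
              ∑ i ∈ Finset.range j, (((h.lfDataT3v3 hc γ hγ hγ1 π).LargeP K j r i).card : ℝ) * σ i)
        ∂fieldMeasure (F.P K) j (Matrix.specialUnitaryGroup (Fin 2) ℂ) ≤ MA)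
    (hT2 : Integrable wtT (fieldMeasure (F.P K) j (Matrix.specialUnitaryGroup (Fin 2) ℂ)) ∧
      ∫ Wf, wtT Wf ∂fieldMeasure (F.P K) j (Matrix.specialUnitaryGroup (Fin 2) ℂ) ≤ MT)
    (hUI : Integrable U (fieldMeasure (F.P K) j (Matrix.specialUnitaryGroup (Fin 2) ℂ))) :
    ∫ Wf in {Wf | ∀ q ∈ S, θ ≤ GaugeGroup.dist1 (GaugeField.plaqHol Wf q)}, U Wf ∂fieldMeasure (F.P K) j (Matrix.specialUnitaryGroup (Fin 2) ℂ) ≤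
      Real.exp (-((S.card : ℝ) * P4)) * (MA + Real.exp Pz * MT) := by
  set D := h.dataT3v3 hc γ hγ hγ1 π with hD
  set W := h.lfDataT3v3 hc γ hγ hγ1 π with hW
  set μ := fieldMeasure (F.P K) j (Matrix.specialUnitaryGroup (Fin 2) ℂ) with hμ
  set triv := Summit.QuantumFields.Balaban3D.Carriers.Hist.triv (F.P K) j with htriv
  set E : Set (GaugeField (F.P K) j (Matrix.specialUnitaryGroup (Fin 2) ℂ)) :=
    {Wf | ∀ q ∈ S, θ ≤ GaugeGroup.dist1 (GaugeField.plaqHol Wf q)} with hE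
  set G : GaugeField (F.P K) j (Matrix.specialUnitaryGroup (Fin 2) ℂ) → ℝ := fun Wf =>
    ∑ r ∈ Finset.univ.erase triv, wt r Wf *
      Real.exp (D.Pint K j r Wf - ∑ i ∈ Finset.range j, ((W.LargeP K j r i).card : ℝ) * σ i) with hG
  set c : ℝ := (S.card : ℝ) * P4 with hcdef
  have hEm : MeasurableSet E := by
    have hEeq : E = ⋂ q ∈ S, {Wf | θ ≤ GaugeGroup.dist1 (GaugeField.plaqHol Wf q)} := by ext Wf; simp [hE]
    rw [hEeq]
    exact S.measurableSet_biInter fun q _ =>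
      measurableSet_le measurable_const (RegularGaugeGroup.measurable_dist1.comp (measurable_plaqHol q))
  -- a.e.: every non-trivial history with non-zero weight is admissible, and so is the windowed trivial one
  have hall : ∀ᵐ Wf ∂μ, ∀ r : Summit.QuantumFields.Balaban3D.Carriers.Hist (F.P K) j, r ≠ triv → wt r Wf ≠ 0 → D.Adm K j r Wf := by
    rw [ae_all_iff]; intro r
    by_cases hr : r = triv
    · exact ae_of_all _ fun Wf h' => absurd hr h'
    · filter_upwards [hT1 r hr] with Wf hWf _ using hWf
  -- the pointwise bound on `E`
  have hpt : ∀ᵐ Wf ∂μ, Wf ∈ E → U Wf ≤ Real.exp (-c) * (G Wf + Real.exp Pz * wtT Wf) := by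
    filter_upwards [hall, hT1'] with Wf hWf hWfT hWE
    rw [hU Wf]
    -- non-trivial terms
    have hterm : ∀ r, r ≠ triv → wt r Wf * Real.exp (-(D.mainT K j r Wf) + D.Pint K j r Wf + D.Zterm K j r) ≤
        Real.exp (-c) * (wt r Wf * Real.exp (D.Pint K j r Wf - ∑ i ∈ Finset.range j, ((W.LargeP K j r i).card : ℝ) * σ i)) := by
      intro r hr
      by_cases hw : wt r Wf = 0
      · rw [hw, zero_mul, zero_mul, mul_zero]
      · have hadm := hWf r hr hw
        have h4 := h4c r Wf hadm hWE
        have hexp : Real.exp (-(D.mainT K j r Wf) + D.Pint K j r Wf + D.Zterm K j r) ≤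
            Real.exp (-c) * Real.exp (D.Pint K j r Wf - ∑ i ∈ Finset.range j, ((W.LargeP K j r i).card : ℝ) * σ i) := by
          rw [← Real.exp_add]
          exact Real.exp_le_exp.mpr (by rw [hcdef]; linarith)
        calc wt r Wf * Real.exp (-(D.mainT K j r Wf) + D.Pint K j r Wf + D.Zterm K j r)
            ≤ wt r Wf * (Real.exp (-c) *
                Real.exp (D.Pint K j r Wf - ∑ i ∈ Finset.range j, ((W.LargeP K j r i).card : ℝ) * σ i)) :=
              mul_le_mul_of_nonneg_left hexp (hwt0 r Wf)
          _ = _ := by ring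
    -- the windowed trivial term: `Pint ≤ Pz`, `Σσ ≥ 0` (4c at the trivial history)
    have htrivterm : wtT Wf * Real.exp (-(D.mainT K j triv Wf) + D.Pint K j triv Wf + D.Zterm K j triv) ≤
        Real.exp (-c) * (Real.exp Pz * wtT Wf) := by
      by_cases hw : wtT Wf = 0
      · rw [hw, zero_mul, mul_zero, mul_zero]
      · have hadm := hWfT hw
        have h4 := h4c triv Wf hadm hWE
        have hsum0 : 0 ≤ ∑ i ∈ Finset.range j, ((W.LargeP K j triv i).card : ℝ) * σ i :=
          Finset.sum_nonneg fun i hi => mul_nonneg (Nat.cast_nonneg _) (hσ i (Finset.mem_range.mp hi))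
        have hP := hPint triv Wf hadm
        have hexp : Real.exp (-(D.mainT K j triv Wf) + D.Pint K j triv Wf + D.Zterm K j triv) ≤ Real.exp (-c) * Real.exp Pz := by
          rw [← Real.exp_add]
          exact Real.exp_le_exp.mpr (by rw [hcdef]; linarith)
        calc wtT Wf * Real.exp (-(D.mainT K j triv Wf) + D.Pint K j triv Wf + D.Zterm K j triv)
            ≤ wtT Wf * (Real.exp (-c) * Real.exp Pz) := mul_le_mul_of_nonneg_left hexp (hwtT0 Wf)
          _ = Real.exp (-c) * (Real.exp Pz * wtT Wf) := by ring
    have hrest : ∑ r ∈ Finset.univ.erase triv, wt r Wf * Real.exp (-(D.mainT K j r Wf) + D.Pint K j r Wf + D.Zterm K j r) ≤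
        Real.exp (-c) * G Wf := by
      rw [hG, Finset.mul_sum]
      exact Finset.sum_le_sum fun r hr => hterm r (Finset.ne_of_mem_erase hr)
    calc wtT Wf * Real.exp (-(D.mainT K j triv Wf) + D.Pint K j triv Wf + D.Zterm K j triv) +
          ∑ r ∈ Finset.univ.erase triv, wt r Wf * Real.exp (-(D.mainT K j r Wf) + D.Pint K j r Wf + D.Zterm K j r)
        ≤ Real.exp (-c) * (Real.exp Pz * wtT Wf) + Real.exp (-c) * G Wf := add_le_add htrivterm hrest
      _ = Real.exp (-c) * (G Wf + Real.exp Pz * wtT Wf) := by ring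
  -- integrate over `E`
  have hGI : Integrable G μ := h4a.1
  have hTI : Integrable wtT μ := hT2.1
  have hRI : Integrable (fun Wf => Real.exp (-c) * (G Wf + Real.exp Pz * wtT Wf)) μ :=
    (hGI.add (hTI.const_mul _)).const_mul _
  have hG0 : ∀ Wf, 0 ≤ G Wf := fun Wf =>
    Finset.sum_nonneg fun r _ => mul_nonneg (hwt0 r Wf) (Real.exp_nonneg _)
  have hstep1 : ∫ Wf in E, U Wf ∂μ ≤ ∫ Wf in E, Real.exp (-c) * (G Wf + Real.exp Pz * wtT Wf) ∂μ :=
    integral_mono_ae hUI.integrableOn hRI.integrableOn ((ae_restrict_iff' hEm).mpr hpt)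
  have hstep2 : ∫ Wf in E, Real.exp (-c) * (G Wf + Real.exp Pz * wtT Wf) ∂μ ≤
      ∫ Wf, Real.exp (-c) * (G Wf + Real.exp Pz * wtT Wf) ∂μ :=
    setIntegral_le_integral hRI (ae_of_all _ fun Wf =>
      mul_nonneg (Real.exp_nonneg _) (add_nonneg (hG0 Wf) (mul_nonneg (Real.exp_nonneg _) (hwtT0 Wf))))
  have hstep3 : ∫ Wf, Real.exp (-c) * (G Wf + Real.exp Pz * wtT Wf) ∂μ =
      Real.exp (-c) * (∫ Wf, G Wf ∂μ + Real.exp Pz * ∫ Wf, wtT Wf ∂μ) := by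
    rw [integral_const_mul, integral_add hGI (hTI.const_mul _), integral_const_mul]
  have hstep4 : Real.exp (-c) * (∫ Wf, G Wf ∂μ + Real.exp Pz * ∫ Wf, wtT Wf ∂μ) ≤
      Real.exp (-c) * (MA + Real.exp Pz * MT) := by
    refine mul_le_mul_of_nonneg_left ?_ (Real.exp_nonneg _)
    exact add_le_add h4a.2 (mul_le_mul_of_nonneg_left hT2.2 (Real.exp_nonneg _))
  calc ∫ Wf in E, U Wf ∂μ ≤ ∫ Wf in E, Real.exp (-c) * (G Wf + Real.exp Pz * wtT Wf) ∂μ := hstep1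
    _ ≤ ∫ Wf, Real.exp (-c) * (G Wf + Real.exp Pz * wtT Wf) ∂μ := hstep2
    _ = Real.exp (-c) * (∫ Wf, G Wf ∂μ + Real.exp Pz * ∫ Wf, wtT Wf ∂μ) := hstep3
    _ ≤ Real.exp (-c) * (MA + Real.exp Pz * MT) := hstep4

end Concrete

/-- The unit `x_i = 1 + log g_{K−i}⁻¹` is monotone down the tower: `x_j ≤ x_i` for `i ≤ j` (and `≥ 1` for `0 < γ ≤ 1`). [cite: Balaban1985UV3, (3) p.256] -/
theorem xlog_mono (F : T3Family) {γ : ℝ} (hγ : 0 < γ) {K i j : ℕ} (hij : i ≤ j) :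
    1 + Real.log (Real.sqrt (γ * ((F.L : ℝ)⁻¹) ^ (K - j)))⁻¹ ≤ 1 + Real.log (Real.sqrt (γ * ((F.L : ℝ)⁻¹) ^ (K - i)))⁻¹ := by
  have hL1 : (1 : ℝ) ≤ (F.L : ℝ) := by exact_mod_cast F.hL.2.le
  have hLi0 : (0 : ℝ) < (F.L : ℝ)⁻¹ := inv_pos.mpr (zero_lt_one.trans_le hL1)
  have hLi1 : (F.L : ℝ)⁻¹ ≤ 1 := inv_le_one_of_one_le₀ hL1
  have hpow : ((F.L : ℝ)⁻¹) ^ (K - i) ≤ ((F.L : ℝ)⁻¹) ^ (K - j) := pow_le_pow_of_le_one hLi0.le hLi1 (by omega)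
  have hgi : 0 < Real.sqrt (γ * ((F.L : ℝ)⁻¹) ^ (K - i)) := Real.sqrt_pos.mpr (mul_pos hγ (pow_pos hLi0 _))
  have hle : Real.sqrt (γ * ((F.L : ℝ)⁻¹) ^ (K - i)) ≤ Real.sqrt (γ * ((F.L : ℝ)⁻¹) ^ (K - j)) :=
    Real.sqrt_le_sqrt (mul_le_mul_of_nonneg_left hpow hγ.le)
  have := Real.log_le_log (inv_pos.mpr (hgi.trans_le hle)) (inv_anti₀ hgi hle)
  linarith

/-- Real bookkeeping of the numerator: `e^{−c}(e^{CM·xN³} + e^{Pz}e^{CT·xN³}) ≤ e^{−c + (CM+CP+CT+CL+1)·xN³}·I` when `Pz ≤ CP·xN³`, `e^{−CL·xN³} ≤ I`,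
`xN³ ≥ 1`. [folklore] -/
theorem mass_budget {CM CP CT CL x N3 Pz I c : ℝ} (hCM : 0 ≤ CM) (hCP : 0 ≤ CP) (hCT : 0 ≤ CT) (ht : 1 ≤ x * N3)
    (hPz : Pz ≤ CP * (x * N3)) (hI : Real.exp (-(CL * x * N3)) ≤ I) :
    Real.exp (-c) * (Real.exp (CM * x * N3) + Real.exp Pz * Real.exp (CT * x * N3)) ≤
      Real.exp (-c + (CM + CP + CT + CL + 1) * x * N3) * I := by
  set t : ℝ := x * N3 with htdef
  have ht0 : 0 ≤ t := zero_le_one.trans ht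
  have e1 : CM * x * N3 = CM * t := by rw [htdef]; ring
  have e2 : CT * x * N3 = CT * t := by rw [htdef]; ring
  have e3 : -(CL * x * N3) = -(CL * t) := by rw [htdef]; ring
  have e4 : -c + (CM + CP + CT + CL + 1) * x * N3 = -c + (CM + CP + CT + CL + 1) * t := by rw [htdef]; ring
  rw [e1, e2, e4]
  rw [e3] at hI
  have hA : Real.exp (CM * t) ≤ Real.exp ((CM + CP + CT) * t) :=
    Real.exp_le_exp.mpr (by nlinarith [mul_nonneg (add_nonneg hCP hCT) ht0])
  have hBB : Real.exp Pz * Real.exp (CT * t) ≤ Real.exp ((CM + CP + CT) * t) := by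
    rw [← Real.exp_add]
    exact Real.exp_le_exp.mpr (by nlinarith [mul_nonneg hCM ht0])
  have h2 : (2 : ℝ) ≤ Real.exp t := by
    have := Real.add_one_le_exp t; linarith
  have hsum : Real.exp (CM * t) + Real.exp Pz * Real.exp (CT * t) ≤ Real.exp ((CM + CP + CT + 1) * t) := by
    calc Real.exp (CM * t) + Real.exp Pz * Real.exp (CT * t) ≤ 2 * Real.exp ((CM + CP + CT) * t) := by linarith
      _ ≤ Real.exp t * Real.exp ((CM + CP + CT) * t) := mul_le_mul_of_nonneg_right h2 (Real.exp_nonneg _)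
      _ = Real.exp ((CM + CP + CT + 1) * t) := by rw [← Real.exp_add]; ring_nf
  have hlow' : Real.exp ((CM + CP + CT + 1) * t) ≤ Real.exp ((CM + CP + CT + CL + 1) * t) * I := by
    have heq : Real.exp ((CM + CP + CT + 1) * t) = Real.exp ((CM + CP + CT + CL + 1) * t) * Real.exp (-(CL * t)) := by
      rw [← Real.exp_add]; ring_nf
    rw [heq]
    exact mul_le_mul_of_nonneg_left hI (Real.exp_nonneg _)
  calc Real.exp (-c) * (Real.exp (CM * t) + Real.exp Pz * Real.exp (CT * t))
      ≤ Real.exp (-c) * (Real.exp ((CM + CP + CT + CL + 1) * t) * I) := mul_le_mul_of_nonneg_left (hsum.trans hlow') (Real.exp_nonneg _)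
    _ = Real.exp (-c + (CM + CP + CT + CL + 1) * t) * I := by rw [← mul_assoc, ← Real.exp_add]

/-- **THE LARGE-FIELD BUDGET AT SMALL-FACTOR CONSTANT `c > 0`** (v5p7): `exp(−c·p(g)² + κ·x^{2+3r₀}) = (exp(−p(g)²/4 + (κ/(4c))·x^{2+3r₀}))^{4c} ≤ C^{4c}·exp(−4c·c₆·p(g)²)`
from v4's `stub_budget` (p442213) read at `κ/(4c)`. [cite: Balaban1985UV3, (71) p.273] -/
theorem budget_of_c (b₀ p₀ r₀ κ c : ℝ) (hb : 0 < b₀) (hr₀ : 0 ≤ r₀) (hκ : 0 ≤ κ) (hp : 1 + 3 * r₀ / 2 < p₀) (hc0 : 0 < c) :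
    ∃ C c' : ℝ, 0 ≤ C ∧ 0 < c' ∧ ∀ g : ℝ, 0 < g → g ≤ 1 →
      Real.exp (-(c * B10.pFun b₀ p₀ g ^ 2) + κ * (1 + Real.log g⁻¹) ^ (2 + 3 * r₀)) ≤ C * Real.exp (-(c' * B10.pFun b₀ p₀ g ^ 2)) := by
  have h4c : 0 < 4 * c := by positivity
  obtain ⟨C, c₆, hC, hc₆, hbud⟩ := HistoryTailBirthV4.stub_budget b₀ p₀ r₀ (κ / (4 * c)) hb hr₀ (by positivity) hp
  refine ⟨C ^ (4 * c), 4 * c * c₆, Real.rpow_nonneg hC _, by positivity, fun g hg hg1 => ?_⟩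
  have h2 : Real.exp (-(B10.pFun b₀ p₀ g ^ 2 / 4) + κ / (4 * c) * (1 + Real.log g⁻¹) ^ (2 + 3 * r₀)) ^ (4 * c) ≤
      (C * Real.exp (-(c₆ * B10.pFun b₀ p₀ g ^ 2))) ^ (4 * c) :=
    Real.rpow_le_rpow (Real.exp_nonneg _) (hbud g hg hg1) h4c.le
  have hl : Real.exp (-(B10.pFun b₀ p₀ g ^ 2 / 4) + κ / (4 * c) * (1 + Real.log g⁻¹) ^ (2 + 3 * r₀)) ^ (4 * c) =
      Real.exp (-(c * B10.pFun b₀ p₀ g ^ 2) + κ * (1 + Real.log g⁻¹) ^ (2 + 3 * r₀)) := by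
    rw [← Real.exp_mul]; congr 1; field_simp
  have hr : (C * Real.exp (-(c₆ * B10.pFun b₀ p₀ g ^ 2))) ^ (4 * c) = C ^ (4 * c) * Real.exp (-(4 * c * c₆ * B10.pFun b₀ p₀ g ^ 2)) := by
    rw [Real.mul_rpow hC (Real.exp_nonneg _), ← Real.exp_mul]; congr 2; ring
  rw [hl, hr] at h2
  exact h2

end Summit.QuantumFields.YangMills.Theorems.HistoryTailLaneNumerator
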